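import Summits.PneNP.GCT.Max.KYSharperLowKPolys
import Mathlib.Data.Nat.Choose.Cast
import Mathlib.Tactic.IntervalCases
import Mathlib.Tactic.Positivity
import Mathlib.Tactic.Linarith
import Mathlib.Tactic.Ring
import Mathlib.Tactic.FieldSimp
import Mathlib.Tactic.LinearCombination
import HarnessLib
import HarnessLib.Audit

/-!
# `GCT/Max`: the low-`k` arithmetic of the sharper Koszul–Young ceiling, PART 2 of 2 — the `k = 1` concavity argument and the
# per-`k` assembly `min(S(m,k)·C(n²,c+1), S(m,k+1)·C(n²,c))·n² ≤ max(CHEB, TK)` for `1 ≤ k ≤ 4`, `m ≥ 5`, `2n ≥ 3m+2`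

Cell `pub-gct-max` (HOME `run/shared/lean/pub/pub-gct-max/`), track F, banked input P4 / W1′a (director-valiant g7, LEAD gen 31
desk). Written and kernel-checked by theory-2 (gen 26); split into two files ≤ 400 lines by engine-1 (gen 20) for the tree's
file-length rule — PART 1 = `Max/KYSharperLowKPolys` (shapes `KYSharper.chebBound` / `KYSharper.tkBound`, glue lemmas, casts, the nine
polynomial inequalities `polyP1`, `polyP4Q`, `polyP5Q`, `polyB2/3/4`, `polyA2/3/4`), PART 2 = this file (byte-identical declarations,
nothing added or removed); mathematics: theory-2 memo `calc33-allm/W1PRIME-NOTES.md` §0–§7 and the gen-26 notes (NOT IN PRINT).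
Everything PROVED; no conjecture of the cell is used or asserted. Main statement `KYSharper.lowK_criterion` = `KYSharper.LowKArithmetic`
of `Max/KYSharperAllM` (its hypothesis `2k+1 ≤ n` is not needed). Scheme: `k ∈ {2,3,4}`: `c ≤ 6` by `B ≤ CHEB` (`polyB_k`, monotone in
`c`), `c ≥ 7` by `A ≤ TK` (`polyA_k` at `c = 7` and linearity in `c`, `lin_mono`); `k = 1`: `c ≤ 4` by `B ≤ CHEB` (`polyP1`), else
`A ≤ TK` when its core holds, else `B ≤ TK` by CONCAVITY in `c` of the `B ≤ TK` defect `P(c)` (`concavity_core`, over `ℚ`): `P(5) ≥ 0` is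
`polyP5Q`, `P(c⋆) ≥ 0` at the real point `c⋆ = S₁(N+1)/(S₁+S₂) - 1` where `A = B` is `polyP4Q`, and the failed `A ≤ TK` core forces
`c < c⋆`. Exact integer cross-checks preceded the formal proof (theory-2 gen 26, `0` violations; see PART 1). HONEST FRAMING:
arithmetic lemmas serving a LOCATED NEGATIVE about ONE family of equations (plain Koszul–Young flattenings `Λ^p ⊗ S^k`) for padded
permanents; occurrence obstructions are ruled out in print (BIP'16) — multiplicity obstructions are the open door; nothing here is a
claim on VP vs VNP or P vs NP.
-/

namespace Summit.PneNP.GCT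

namespace KYSharper

open Finset KYAllM

/-! ## `k = 1`: the concavity argument for `B ≤ TK` between `c = 5` and the crossing point `c⋆` -/

/-- **Concavity core (`k = 1`, over `ℚ`).** With `N = n²`, `D = C₂(N-n+1) - S₁N`, the `A ≤ TK` defect `F(x) = (x+2)D - C₂(N+1)` is
linear and the `B ≤ TK` defect `P(x) = C₂(N-x)((N-n+1)x + (n-1)²) - S₂N(x+1)(x+2)` is a concave quadratic with
`P(x) = (N-x)F(x) + N(x+2)(S₁(N-x) - S₂(x+1))`. At the real point `z = S₁(N+1)/(S₁+S₂) - 1` (where the two low-order bounds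
`A`, `B` cross) the last bracket vanishes, `F(z) ≥ 0` is `P4`, so `P(z) ≥ 0`; `P(5) ≥ 0` is `P5`; a failed `A ≤ TK` core `F(c) < 0`
forces `c < z`; concavity on `[5, z]` gives `P(c) ≥ 0`, which is the `B ≤ TK` core. [folklore] -/
theorem concavity_core (S₁ S₂ C₂ n c : ℚ) (hS₁ : 0 < S₁) (hS₂ : 0 < S₂) (hC₂ : 0 < C₂) (hn : 1 ≤ n) (hc5 : 5 ≤ c)
    (hP5 : 42 * S₂ * n ^ 2 ≤ C₂ * (n ^ 2 - 5) * (6 * n ^ 2 - 7 * n + 6))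
    (hP4 : (S₁ * (n ^ 2 + 2) + S₂) * (S₁ * n ^ 2) + C₂ * (n ^ 2 + 1) * (S₁ + S₂)
      ≤ (S₁ * (n ^ 2 + 2) + S₂) * (C₂ * (n ^ 2 - n + 1)))
    (hnotA : (c + 2) * (C₂ * (n ^ 2 - n + 1)) < (c + 2) * (S₁ * n ^ 2) + C₂ * (n ^ 2 + 1)) :
    S₂ * n ^ 2 * (c + 1) * (c + 2) + C₂ * (n ^ 2 - c) * (n ^ 2 - c - 1) ≤ C₂ * (n ^ 2 - n) * (n ^ 2 - c) * (c + 2) := by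
  set N := n ^ 2 with hN
  set D := C₂ * (N - n + 1) - S₁ * N with hD
  set W := S₁ + S₂ with hW
  have hWpos : 0 < W := by rw [hW]; linarith
  set z := S₁ * (N + 1) / W - 1 with hz
  have hz1 : (z + 1) * W = S₁ * (N + 1) := by rw [hz]; field_simp; ring
  have hz2 : (z + 2) * W = S₁ * (N + 2) + S₂ := by linear_combination hz1
  -- `F(z) ≥ 0` from `P4`
  have hP4' : C₂ * (N + 1) * W ≤ (S₁ * (N + 2) + S₂) * D := by rw [hD, hW]; linarith
  have hFz : C₂ * (N + 1) ≤ (z + 2) * D := by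
    have h1 : (C₂ * (N + 1)) * W ≤ ((z + 2) * D) * W := by rw [mul_assoc (z + 2), mul_comm D W, ← mul_assoc, hz2]; exact hP4'
    exact le_of_mul_le_mul_right h1 hWpos
  -- `D > 0`
  have hNpos : 0 < N + 1 := by positivity
  have hDpos : 0 < D := by
    by_contra hle
    push Not at hle
    have h1 : (S₁ * (N + 2) + S₂) * D ≤ 0 := mul_nonpos_of_nonneg_of_nonpos (by positivity) hle
    have h2 : 0 < C₂ * (N + 1) * W := by positivity
    linarith
  -- `c < z`
  have hcz : c < z := by
    have h1 : (c + 2) * D < (z + 2) * D := by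
      have h2 : (c + 2) * D < C₂ * (N + 1) := by rw [hD]; linarith
      exact lt_of_lt_of_le h2 hFz
    have h3 := lt_of_mul_lt_mul_right h1 hDpos.le
    linarith
  -- `z < N`
  have hzN : z < N := by
    have h1 : (z + 1) * W < (N + 1) * W := by rw [hz1, hW]; nlinarith
    have h2 := lt_of_mul_lt_mul_right h1 hWpos.le
    linarith
  -- the quadratic `P`
  set P : ℚ → ℚ := fun x => C₂ * (N - x) * ((N - n + 1) * x + (n - 1) ^ 2) - S₂ * N * (x + 1) * (x + 2) with hP
  have hPF : ∀ x, P x = (N - x) * ((x + 2) * D - C₂ * (N + 1)) + N * (x + 2) * (S₁ * (N - x) - S₂ * (x + 1)) := by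
    intro x; simp only [hP, hD, hN]; ring
  have hvanish : S₁ * (N - z) - S₂ * (z + 1) = 0 := by linear_combination (-1 : ℚ) * hz1
  have hPz : 0 ≤ P z := by
    rw [hPF z, hvanish, mul_zero, add_zero]
    exact mul_nonneg (by linarith) (by linarith)
  have hP5' : 0 ≤ P 5 := by simp only [hP, hN]; nlinarith [hP5]
  -- concavity: `(z-5)·P(c) = (z-c)·P(5) + (c-5)·P(z) + α(z-5)(z-c)(c-5)`, `α = C₂(N-n+1) + S₂N ≥ 0`
  have hid : (z - 5) * P c = (z - c) * P 5 + (c - 5) * P z + (C₂ * (N - n + 1) + S₂ * N) * (z - 5) * (z - c) * (c - 5) := by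
    simp only [hP]; ring
  have hα : 0 ≤ C₂ * (N - n + 1) + S₂ * N := by
    have h1 : 0 ≤ N - n := by rw [hN]; nlinarith
    positivity
  have hPc : 0 ≤ P c := by
    by_contra hneg
    push Not at hneg
    have h1 : (z - 5) * P c < 0 := mul_neg_of_pos_of_neg (by linarith) hneg
    have h2 : 0 ≤ (z - c) * P 5 := mul_nonneg (by linarith) hP5'
    have h3 : 0 ≤ (c - 5) * P z := mul_nonneg (by linarith) hPz
    have h4 : 0 ≤ (C₂ * (N - n + 1) + S₂ * N) * (z - 5) * (z - c) * (c - 5) :=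
      mul_nonneg (mul_nonneg (mul_nonneg hα (by linarith)) (by linarith)) (by linarith)
    linarith
  have hgoal : C₂ * (N - n) * (N - c) * (c + 2) - (S₂ * N * (c + 1) * (c + 2) + C₂ * (N - c) * (N - c - 1)) = P c := by
    simp only [hP]; ring
  linarith

/-- **The `B ≤ TK` core for `k = 1`** (`c ≥ 5`, the `A ≤ TK` core failing): with `n² = c+1+u`,
`S₂·n²·(c+1)(c+2) + C(n,2)·C(n-1,0)·(u+1)·u ≤ C(n,2)·n·C(n-1,1)·(u+1)·(c+2)`. [folklore] -/
theorem btk_core_one (m n c u : ℕ) (hm : 5 ≤ m) (hn : 3 * m + 2 ≤ 2 * n) (hc5 : 5 ≤ c) (hu : n * n = c + 1 + u)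
    (hnotA : ¬ ((c + 2) * (chooseSqSum m 1 * n ^ 2) + n.choose (1 + 1) * (n - 1).choose (1 - 1) * (n * n + 1)
      ≤ (c + 2) * (n.choose (1 + 1) * (n * (n - 1).choose 1 + (n - 1).choose (1 - 1))))) :
    chooseSqSum m 2 * n ^ 2 * (c + 1) * (c + 2) + n.choose (1 + 1) * (n - 1).choose (1 - 1) * (u + 1) * u
      ≤ n.choose (1 + 1) * n * (n - 1).choose 1 * (u + 1) * (c + 2) := by
  have hP4 := polyP4Q m n hm hn
  have hP5 := polyP5Q m n hm hn
  obtain ⟨v, rfl⟩ : ∃ v, n = v + 1 := ⟨n - 1, by omega⟩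
  simp only [Nat.add_sub_cancel, Nat.sub_self, Nat.choose_zero_right, Nat.choose_one_right, mul_one] at hnotA ⊢
  push Not at hnotA
  push_cast at hP4 hP5
  have hS₁ : (0 : ℚ) < (chooseSqSum m 1 : ℕ) := by
    have h : 0 < chooseSqSum m 1 := by rw [chooseSqSum_one]; positivity
    exact_mod_cast h
  have hS₂ : (0 : ℚ) < (chooseSqSum m 2 : ℕ) := by
    have h : 0 < chooseSqSum m 2 := by rw [chooseSqSum_two]; positivity
    exact_mod_cast h
  have hC₂ : (0 : ℚ) < ((v + 1).choose 2 : ℕ) := by exact_mod_cast Nat.choose_pos (by omega : 2 ≤ v + 1)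
  have hvn : (1 : ℚ) ≤ (v : ℚ) + 1 := by have h : (0 : ℚ) ≤ v := Nat.cast_nonneg v; linarith
  have hc5q : (5 : ℚ) ≤ (c : ℚ) := by exact_mod_cast hc5
  have huq : (u : ℚ) = ((v : ℚ) + 1) ^ 2 - c - 1 := by
    have h : (((v + 1) * (v + 1) : ℕ) : ℚ) = ((c + 1 + u : ℕ) : ℚ) := by rw [hu]
    push_cast at h
    linarith
  have hA : ((c : ℚ) + 2) * ((((v + 1).choose 2 : ℕ) : ℚ) * (((v : ℚ) + 1) ^ 2 - ((v : ℚ) + 1) + 1))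
      < ((c : ℚ) + 2) * (((chooseSqSum m 1 : ℕ) : ℚ) * ((v : ℚ) + 1) ^ 2) + (((v + 1).choose 2 : ℕ) : ℚ) * (((v : ℚ) + 1) ^ 2 + 1) := by
    have h := (Nat.cast_lt (α := ℚ)).mpr hnotA
    push_cast at h
    linarith
  have key := concavity_core _ _ _ ((v : ℚ) + 1) c hS₁ hS₂ hC₂ hvn hc5q hP5 hP4 hA
  have goalQ : ((chooseSqSum m 2 * (v + 1) ^ 2 * (c + 1) * (c + 2) + (v + 1).choose 2 * (u + 1) * u : ℕ) : ℚ)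
      ≤ (((v + 1).choose 2 * (v + 1) * v * (u + 1) * (c + 2) : ℕ) : ℚ) := by
    push_cast
    rw [huq]
    linarith
  exact_mod_cast goalQ

/-! ## Assembly per `k` -/

/-- `k = 1`: `c ≤ 4` by `B ≤ CHEB` (`P1`), else `A ≤ TK` when its core holds, else `B ≤ TK` (`btk_core_one`). [folklore] -/
theorem lowK_one (m n c u : ℕ) (hm : 5 ≤ m) (hn : 3 * m + 2 ≤ 2 * n) (hu : n * n = c + 1 + u) :
    min (chooseSqSum m 1 * (n * n).choose (c + 1)) (chooseSqSum m (1 + 1) * (n * n).choose c) * n ^ 2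
      ≤ max (chebBound n c 1) (tkBound n c 1) := by
  apply min_mul_le_max
  rcases Nat.lt_or_ge c 5 with hc4 | hc5
  · -- `B ≤ CHEB`
    refine Or.inr (Or.inr (Or.inl (bcheb_glue _ n c 1 u hu ?_)))
    have hP1 := polyP1 m n hm hn
    rw [hu] at hP1
    have h1 : (n.choose 2) ^ 2 * c ≤ (n.choose 2) ^ 2 * 4 := Nat.mul_le_mul_left _ (by omega)
    calc chooseSqSum m (1 + 1) * n ^ 2 * (c + 1) ≤ chooseSqSum m 2 * n ^ 2 * 5 := Nat.mul_le_mul_left _ (by omega)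
      _ ≤ (n.choose (1 + 1)) ^ 2 * (u + 1) := by nlinarith [hP1, h1]
  by_cases hA : (c + 2) * (chooseSqSum m 1 * n ^ 2) + n.choose (1 + 1) * (n - 1).choose (1 - 1) * (n * n + 1)
      ≤ (c + 2) * (n.choose (1 + 1) * (n * (n - 1).choose 1 + (n - 1).choose (1 - 1)))
  · -- `A ≤ TK`
    exact Or.inr (Or.inl (atk_glue _ n c 1 u hu hA))
  · -- `B ≤ TK`
    exact Or.inr (Or.inr (Or.inr (btk_glue _ n c 1 u hu (btk_core_one m n c u hm hn hc5 hu hA))))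

/-- `k ∈ {2,3,4}` from the two polynomial inequalities `B_k`, `A_k`: `c ≤ 6` by `B ≤ CHEB`, `c ≥ 7` by `A ≤ TK`. [folklore] -/
theorem lowK_of_polys (m n c k u : ℕ) (hu : n * n = c + 1 + u)
    (hB : 7 * (chooseSqSum m (k + 1) * n ^ 2) + 6 * (n.choose (k + 1)) ^ 2 ≤ (n.choose (k + 1)) ^ 2 * (n * n))
    (hA : 9 * (chooseSqSum m k * n ^ 2) + n.choose (k + 1) * (n - 1).choose (k - 1) * (n * n + 1)
      ≤ 9 * (n.choose (k + 1) * (n * (n - 1).choose k + (n - 1).choose (k - 1)))) :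
    min (chooseSqSum m k * (n * n).choose (c + 1)) (chooseSqSum m (k + 1) * (n * n).choose c) * n ^ 2
      ≤ max (chebBound n c k) (tkBound n c k) := by
  apply min_mul_le_max
  rcases Nat.lt_or_ge c 7 with hc6 | hc7
  · -- `B ≤ CHEB`
    refine Or.inr (Or.inr (Or.inl (bcheb_glue _ n c k u hu ?_)))
    rw [hu] at hB
    have h1 : (n.choose (k + 1)) ^ 2 * c ≤ (n.choose (k + 1)) ^ 2 * 6 := Nat.mul_le_mul_left _ (by omega)
    calc chooseSqSum m (k + 1) * n ^ 2 * (c + 1) ≤ chooseSqSum m (k + 1) * n ^ 2 * 7 := Nat.mul_le_mul_left _ (by omega)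
      _ ≤ (n.choose (k + 1)) ^ 2 * (u + 1) := by nlinarith [hB, h1]
  · -- `A ≤ TK`
    refine Or.inr (Or.inl (atk_glue _ n c k u hu ?_))
    have hαγ : chooseSqSum m k * n ^ 2 ≤ n.choose (k + 1) * (n * (n - 1).choose k + (n - 1).choose (k - 1)) :=
      Nat.le_of_mul_le_mul_left ((Nat.le_add_right _ _).trans hA) (by norm_num : 0 < 9)
    exact lin_mono _ _ _ 9 (c + 2) hA hαγ (by omega)

/-- **Low-`k` criterion (threshold `2n ≥ 3m+2`).** For `m ≥ 5`, `3m+2 ≤ 2n`, `1 ≤ k ≤ 4`, `c+1 ≤ n²`: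
`min(S(m,k)·C(n²,c+1), S(m,k+1)·C(n²,c))·n² ≤ max(CHEB(n,c,k), TK(n,c,k))`; this is `KYSharper.LowKArithmetic` of
`Max/KYSharperAllM` (whose extra hypothesis `2k+1 ≤ n` is not needed). [folklore] -/
theorem lowK_criterion (m n c k : ℕ) (hm : 5 ≤ m) (hn : 3 * m + 2 ≤ 2 * n) (hk1 : 1 ≤ k) (hk4 : k ≤ 4) (hc : c + 1 ≤ n * n) :
    min (chooseSqSum m k * (n * n).choose (c + 1)) (chooseSqSum m (k + 1) * (n * n).choose c) * n ^ 2
      ≤ max (chebBound n c k) (tkBound n c k) := by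
  obtain ⟨u, hu⟩ : ∃ u, n * n = c + 1 + u := ⟨n * n - (c + 1), by omega⟩
  rcases (show k = 1 ∨ k = 2 ∨ k = 3 ∨ k = 4 by omega) with rfl | rfl | rfl | rfl
  · exact lowK_one m n c u hm hn hu
  · exact lowK_of_polys m n c 2 u hu (polyB2 m n hm hn) (polyA2 m n hm hn)
  · exact lowK_of_polys m n c 3 u hu (polyB3 m n hm hn) (polyA3 m n hm hn)
  · exact lowK_of_polys m n c 4 u hu (polyB4 m n hm hn) (polyA4 m n hm hn)

end KYSharper

end Summit.PneNP.GCT
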